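import Literature.AnabelianGeometry.EtaleTheta.Discharge.Sec3Prop34CnstOfGaloisCovering
import Literature.AnabelianGeometry.EtaleTheta.TemperedFrobenioidCnstTorsion

/-!
# [EtTh] Thm. 3.7 (iii), the `Λ = ℚ` clause at the constructed Def. 3.3 (iii) data: `Prop34Cnst₀Torsion` over the
# connected coverings dominated by `Z^log_∞`, from the TORSION form of the Galois-correspondence binder

S. Mochizuki, *The étale theta function …*, Publ. RIMS **45** (2009) [MochizukiEtTh2009], §3, Prop. 3.4 (ii) p.74 and the
step of the proof of Thm. 3.7 (iii), p.80: for `Λ = ℚ` the functor `C → D^cnst` is faithful because «`Aut(L/K)` acts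
faithfully on `O_L^×`» read on the PERFECTION `(O_L^×)^pf = O_L^× ⊗ ℚ`, i.e. on `O_L^×` UP TO TORSION
[cite: MochizukiEtTh2009, Thm 3.7 (iii) p.79].  abc-iut cell, layer L2; L2-lead R281 (2) (seat abc-iut-L2-t3 gen 5,
owner of `DivisorMonoids.Prop34Cnst₀Torsion`, census A3 p440182); sequel to abc-iut-w6-d058's
`Sec3Prop34CnstOfGaloisCovering` (p441022: `Prop34Cnst₀` at `ofGaloisActionConnected`, clause 3 from `ConstGaloisLaw`).
PROOF-ONLY except ONE class-(c) `Prop`-valued binder on abc-iut-w6-d058's model data; nothing landed is edited.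

* `GaloisAction.ConstGaloisLawTorsion A` — the torsion form of abc-iut-w6-d058's binder `ConstGaloisLaw` (G-w6d058-2): an
  element of `G` fixing every `H`-invariant unit integral constant UP TO TORSION lies in `N·H` («`Aut(L/K)` faithful on
  `O_L^× ⊗ ℚ`»); it implies `ConstGaloisLaw` (`ConstGaloisLawTorsion.constGaloisLaw`) and holds for the trivial action.
* `DivisorMonoids.prop34Cnst₀Torsion_ofGaloisActionConnected` — **census A3's predicate `Prop34Cnst₀Torsion` (the `Λ = ℚ`
  clause `hQ` of GAP G-w4d084-2) HOLDS at `ofGaloisActionConnected A hZ` with `cnst := A.cnstFunctor`**, from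
  `ConstGaloisLawTorsion` — same orbit argument as abc-iut-w6-d058's `cnst_map_eq_of_B₀_map_eq_ofGaloisActionConnected`,
  with «equal» replaced by «equal up to an `N`-th power» (`exists_bZero_of_stab_invariant` consumed BY NAME).
Why a torsion binder is NEEDED and not derivable from `ConstGaloisLaw`: torsion in `Ker(div₀)` (print: `μ(L) ⊆ O_L^×`) is
the exact obstruction — abc-iut-L2-t3's kernel countermodel `TemperedFrobenioidToyTorsion` (p437160).
HONEST FRAMING: refereed pre-IUT material; binder + implication at model data; typed ≠ proved; nothing here bears on the
disputed [IUTchIII] Cor. 3.12.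
-/

noncomputable section

namespace Literature.AnabelianGeometry.EtaleTheta

open CategoryTheory Opposite Literature.AlgebraicGeometry.Frobenioids

universe u

namespace LogDivisorModel.GaloisAction

variable {Z : LogDivisorModel.{u}} {G : Type u} [Group G] (A : Z.GaloisAction G)

/-- **Galois correspondence for the constant field, TORSION (unit ⊗ ℚ) form** (predicate bundle, class (c); BINDER):
an element of `G` fixing every `H`-invariant unit integral constant UP TO TORSION (`(a·u)^N = u^N` for some `N ≥ 1`)
lies in `N·H` (`N = constInertia`).  In print: "`Aut(L/K)` acts faithfully on `O_L^×`" applied on the perfection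
`(O_L^×)^pf` for `Λ = ℚ` (Thm. 3.7 (iii), p.80). [cite: MochizukiEtTh2009, Thm 3.7 (iii) p.79] -/
structure ConstGaloisLawTorsion : Prop where
  /-- an element fixing all `H`-invariant unit integral constants up to torsion lies in `N·H` -/
  exists_mem_constInertia : ∀ (H : Subgroup G) (a : G),
    (∀ u : Z.Fn, u ∈ Z.intConst → u⁻¹ ∈ Z.intConst → (∀ h ∈ H, A.actFn h u = u) →
      ∃ N : ℕ+, (A.actFn a u) ^ (N : ℕ) = u ^ (N : ℕ)) →
      ∃ n ∈ A.constInertia, n⁻¹ * a ∈ H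

/-- The torsion form implies abc-iut-w6-d058's `ConstGaloisLaw` (exact fixing is fixing up to the first power).
[cite: MochizukiEtTh2009, Thm 3.7 (iii) p.79] -/
theorem ConstGaloisLawTorsion.constGaloisLaw (h : A.ConstGaloisLawTorsion) : A.ConstGaloisLaw :=
  ⟨fun H a ha => h.exists_mem_constInertia H a fun u hu hu' hH => ⟨1, by rw [PNat.one_coe, pow_one, pow_one, ha u hu hu' hH]⟩⟩

/-- The trivial action satisfies the torsion law (`N = G`): the binder is inhabited.
[cite: MochizukiEtTh2009, Thm 3.7 (iii) p.79] -/
theorem constGaloisLawTorsion_trivial (Z : LogDivisorModel.{u}) (G : Type u) [Group G] :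
    (GaloisAction.trivial Z G).ConstGaloisLawTorsion :=
  ⟨fun H a _ => ⟨a, fun _ _ => rfl, by rw [inv_mul_cancel]; exact H.one_mem⟩⟩

end LogDivisorModel.GaloisAction

namespace DivisorMonoids

open LogDivisorModel.GaloisAction

variable {Z : LogDivisorModel.{u}} {G : Type u} [Group G] (A : Z.GaloisAction G) (hZ : Z.CuspLaws)

/-- `(g h) · s = g · (h · s)` for the structure action of a `G`-set. [folklore] -/
private theorem ρ_mul_apply (S : Action (Type u) G) (g h : G) (s : S.V) : S.ρ (g * h) s = S.ρ g (S.ρ h s) := by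
  rw [map_mul]; rfl

/-- **Census A3 at the constructed data: `Prop34Cnst₀Torsion (ofGaloisActionConnected A hZ) A.cnstFunctor`** — the
`Λ = ℚ` faithfulness clause of Thm. 3.7 (iii) («faithful on `(O_L^×)^pf`») HOLDS over the connected coverings dominated
by `Z^log_∞`, given the torsion Galois-correspondence binder: automorphisms `g, g'` of a connected covering acting
identically UP TO TORSION on the families with trivial divisor (`= Hom_G(Y, O^×)`) have the same image in `Aut_{D^cnst}`.
Proof: for a point `s`, pick `a` with `a·(g s) = g' s` and `H := Stab(g s)`; an `H`-invariant unit constant `u` extends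
to a family `b` with `b(c·(g s)) = c·u` and trivial divisor (abc-iut-w6-d058's `exists_bZero_of_stab_invariant`);
evaluating `(g^*b)^N = (g'^*b)^N` at `s` gives `u^N = (a·u)^N`; so `a ∈ N·H`, i.e. `g s` and `g' s` are `N`-translates.
[cite: MochizukiEtTh2009, Thm 3.7 (iii) p.79] -/
theorem prop34Cnst₀Torsion_ofGaloisActionConnected (hGCt : A.ConstGaloisLawTorsion) :
    (ofGaloisActionConnected A hZ).Prop34Cnst₀Torsion A.cnstFunctor where
  cnst_map_eq_of_B₀_map_pow_eq := by
    intro Y g g' hker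
    rw [cnstFunctor_map_eq_iff]
    intro s
    obtain ⟨a, ha⟩ := Y.property.2 (g.hom.hom.hom s) (g'.hom.hom.hom s)
    let H : Subgroup G :=
      { carrier := {h | Y.obj.ρ h (g.hom.hom.hom s) = g.hom.hom.hom s}
        mul_mem' := fun {c d} hc hd => by
          show Y.obj.ρ (c * d) _ = _
          rw [ρ_mul_apply, hd, hc]
        one_mem' := by
          show Y.obj.ρ 1 _ = _
          rw [map_one]; rfl
        inv_mem' := fun {c} hc => by
          show Y.obj.ρ c⁻¹ _ = _
          conv_lhs => rw [← hc]
          rw [← ρ_mul_apply, inv_mul_cancel, map_one]; rfl }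
    obtain ⟨n, hn, hnH⟩ := hGCt.exists_mem_constInertia H a fun u hu hu' hinvH => by
      obtain ⟨b, hb1, hbval⟩ :=
        A.exists_bZero_of_stab_invariant Y.obj Y.property (g.hom.hom.hom s) hu hu' fun h hh => hinvH h hh
      obtain ⟨N, hN⟩ := hker b hb1
      refine ⟨N, ?_⟩
      have hk := congrArg (fun c : A.bZero Y.obj => c.1 s) hN
      change b.1 (g.hom.hom.hom s) ^ (N : ℕ) = b.1 (g'.hom.hom.hom s) ^ (N : ℕ) at hk
      have e1 : b.1 (g.hom.hom.hom s) = u := by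
        have h := hbval 1
        rw [map_one, map_one, MulAut.one_apply] at h
        exact h
      rw [← ha, hbval a, e1] at hk
      exact hk.symm
    refine ⟨n, hn, ?_⟩
    have h1 : Y.obj.ρ (n⁻¹ * a) (g.hom.hom.hom s) = g.hom.hom.hom s := hnH
    rw [← ha]
    calc Y.obj.ρ n (g.hom.hom.hom s) = Y.obj.ρ n (Y.obj.ρ (n⁻¹ * a) (g.hom.hom.hom s)) := by rw [h1]
      _ = Y.obj.ρ a (g.hom.hom.hom s) := by rw [← ρ_mul_apply, mul_inv_cancel_left]

/-- With the torsion binder, BOTH census-A3 predicates hold at the constructed data: `Prop34Cnst₀` (abc-iut-w6-d058's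
`prop34Cnst₀_ofGaloisActionConnected` via `ConstGaloisLawTorsion.constGaloisLaw`) and `Prop34Cnst₀Torsion`.
[cite: MochizukiEtTh2009, Prop 3.4 (ii) p.74] -/
theorem prop34Cnst₀_and_torsion_ofGaloisActionConnected (hGCt : A.ConstGaloisLawTorsion) :
    (ofGaloisActionConnected A hZ).Prop34Cnst₀ A.cnstFunctor ∧
      (ofGaloisActionConnected A hZ).Prop34Cnst₀Torsion A.cnstFunctor :=
  ⟨prop34Cnst₀_ofGaloisActionConnected A hZ hGCt.constGaloisLaw, prop34Cnst₀Torsion_ofGaloisActionConnected A hZ hGCt⟩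

end DivisorMonoids

end Literature.AnabelianGeometry.EtaleTheta

end
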